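import Summits.CriticalPhenomena.PercolationContinuityZ3.Theorems.Transplant.SkelPhiRootRooms
import Summits.CriticalPhenomena.PercolationContinuityZ3.Theorems.Transplant.SkelPhiCellsSmallM
import Summits.CriticalPhenomena.PercolationContinuityZ3.Theorems.Transplant.SkelPhiRootFoot
import HarnessLib

/-!
# N1 (the `{±1}` node), (R) column ((R6c) prerequisite; NEG-SCOPE B.15): THE ROOT ROOMS AT THE SMALL-BOX SCHEME `cellGeomSG₂b` —
# ruling B.15 shrank the arrival boxes to `M_x := VWin ψ (P.Mb b₀ x) (rM a x)` (hp-8 g33's defeq twin `cellGeomSG₂b`, p292701); this file supplies the two membership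
# tests the generic (R) chain (`rootOblTWAt_of_numbers_x/_y`) asks of the scheme: `mem_Mb_stepVec_of_levels` (planar), **`mem_rootMb_of_footprint`** (the target box:
# signed level within `b₀∥ − 1` of `20r∥`, transverse `≤ b₀⊥ − 1` ⇒ `v ∈ M_{0+du}` of the twin) and **`mem_U0rootb_of_footprint`** (the root world of the twin = that of
# `cellGeomSG₂`, so `mem_U0root_of_footprint` transfers by the `rfl` projections), both also in `FootBox` form (`hMfoot_b`, `hUfoot_b`) ready for `rootOblTWAt_of_numbers_x/_y`

builds on p205010 (kernel theorem, internal audit signed; external expert review pending) — nothing in this file uses p205010; nothing here is a claim about the open node.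
Lane `prim-bschramm`, seat `prim-bschramm-p3` (gen 9; design owner + (R) owner); helper file (`--supports stmt-CriticalPhenomena-4575 --as helper`).
[cite: KozmaNitzan2024, §4 p. 26 (M_v), p. 28] [cite: MartineauTassion2017, §4.1]
-/

noncomputable section

open scoped Classical

namespace Summit.CriticalPhenomena.PercolationContinuityZ3.Theorems

namespace Transplant

namespace Skelφ

open Literature.Probability.Percolation Literature.Probability.LatticeModels SimpleGraph KNCells
open Literature.Probability.Percolation.KozmaNitzan
open Literature.Probability.Percolation.KozmaNitzan.Cells (oth oth_ne sgOf sgOf_sign stepVec_apply_fst stepVec_apply_oth eq_oth_of_ne oth_oth)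
open Literature.Barriers.CriticalPhenomena (graphBall mem_graphBall_self graphBall_mono)
open BoxProdZ2 (ConcRadiiG)

variable {V : Type} [DecidableEq V] {G : SimpleGraph V} [G.LocallyFinite] {ψ : V → Site 2}

/-! ## §1 The small target box, planar -/

/-- **Into the small box of the next cell from the levels**: `|sg·z∥ − 20r∥| ≤ b₀∥`, `|z⊥| ≤ b₀⊥` ⇒ `z ∈ Mb b₀ (0 + du)`. [folklore] -/
theorem mem_Mb_stepVec_of_levels (P : PCells2) (du : MDir) {b₀ : Fin 2 → ℕ} {z : Site 2} (ha : |sgOf du * z du.1 - 20 * (P.r du.1 : ℤ)| ≤ b₀ du.1)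
    (hb : |z (oth du.1)| ≤ b₀ (oth du.1)) : z ∈ P.Mb b₀ ((0 : Site 2) + stepVec du) := by
  rw [PCells2.mem_Mb_iff]
  intro i
  simp only [zero_add, PCells2.cen_apply]
  have hσ := sgOf_sign du
  by_cases hi : i = du.1
  · subst hi
    rw [stepVec_apply_fst]
    have h1 := (abs_le.1 ha).1
    have h2 := (abs_le.1 ha).2
    rcases hσ with h | h <;> rw [h] at h1 h2 ⊢ <;> constructor <;> linarith
  · rw [eq_oth_of_ne hi, stepVec_apply_oth]
    exact ⟨by linarith [(abs_le.1 hb).1], by linarith [(abs_le.1 hb).2]⟩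

/-! ## §2 The rooms at the twin scheme -/

section Rooms

variable (P : PCells2) (t : V) (Λ : ConcRadiiG) (du : MDir) (b₀ : Fin 2 → ℕ)

/-- **INTO THE SMALL TARGET BOX `M_{0+du}` OF THE TWIN SCHEME**: a vertex of the ball of radius `R`, `R + 1 ≤ rM`, with signed level within `b₀∥ − 1` of `20r∥` and
transverse coordinate `≤ b₀⊥ − 1` in absolute value, lies in `M 0 (0 + du)` (one unit of margin for the edge span). [cite: KozmaNitzan2024, §4 p. 26 (M_v)] -/
theorem mem_rootMb_of_footprint (hlip : Lip G ψ) (hws : WeakSteps G ψ) {R : ℕ} (hR : R + 1 ≤ Λ.rM 0 ((0 : Site 2) + stepVec du)) {v : V}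
    (hv : v ∈ graphBall G t R) (ha : |sgOf du * ψ v du.1 - 20 * (P.r du.1 : ℤ)| ≤ (b₀ du.1 : ℤ) - 1)
    (hb : |ψ v (oth du.1)| ≤ (b₀ (oth du.1) : ℤ) - 1) :
    v ∈ (cellGeomSG₂b G ψ P t Λ b₀).M 0 ((0 : Site 2) + stepVec du) := by
  rw [cellGeomSG₂b_M]
  obtain ⟨m, hadj, -, -, -⟩ := exists_adj_upBox hlip hws P du 0 v
  obtain ⟨hl, ht⟩ := levels_of_adj du hlip hadj
  refine mem_VWin_of_adj_footprints hv hR hadj (mem_Mb_stepVec_of_levels P du (ha.trans (by linarith)) (hb.trans (by linarith)))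
    (mem_Mb_stepVec_of_levels P du ?_ ?_)
  · have h1 := abs_le.1 ha; have h2 := abs_le.1 hl
    exact abs_le.2 ⟨by linarith [h1.1, h2.1], by linarith [h1.2, h2.2]⟩
  · have h1 := abs_le.1 hb; have h2 := abs_le.1 ht
    exact abs_le.2 ⟨by linarith [h1.1, h2.1], by linarith [h1.2, h2.2]⟩

/-- **INTO THE ROOT WORLD OF THE TWIN SCHEME** (`U0root` does not read the arrival box): `mem_U0root_of_footprint` transferred. [cite: KozmaNitzan2024, §4 p. 26] -/
theorem mem_U0rootb_of_footprint (q : unitInterval) (δc : ℝ) (hlip : Lip G ψ) (hws : WeakSteps G ψ) {R : ℕ} (hRQ : R + 1 ≤ Λ.rQ 0 0)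
    (hRB : R + 1 ≤ Λ.rB 0 0 du) (hRQ' : R + 1 ≤ Λ.rQ 0 ((0 : Site 2) + stepVec du)) {v : V} (hv : v ∈ graphBall G t R)
    (h₁ : -(5 * (P.r du.1 : ℤ)) + 1 ≤ sgOf du * ψ v du.1) (h₂ : sgOf du * ψ v du.1 ≤ 25 * (P.r du.1 : ℤ) - 1)
    (hb : |ψ v (oth du.1)| ≤ 5 * (P.r (oth du.1) : ℤ) - 2) :
    v ∈ (⟨cellGeomSG₂b G ψ P t Λ b₀, q, δc⟩ : KSchA V ℕ).U0root du := by
  have h := mem_U0root_of_footprint P t Λ q δc du hlip hws hRQ hRB hRQ' hv h₁ h₂ hb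
  have e : (⟨cellGeomSG₂b G ψ P t Λ b₀, q, δc⟩ : KSchA V ℕ).U0root du = (⟨cellGeomSG₂ G ψ P t Λ, q, δc⟩ : KSchA V ℕ).U0root du := by
    simp only [KSchA.U0root, cellGeomSG₂b_Q, cellGeomSG₂b_Ewv, cellGeomSG₂b_a₀]; rfl
  rw [e]; exact h

end Rooms

end Skelφ

end Transplant

end Summit.CriticalPhenomena.PercolationContinuityZ3.Theorems

end
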